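import Literature.NumberTheory.IwasawaTheory.Greenberg2006.LOC1OfLocalH2Vanishing
import Literature.NumberTheory.IwasawaTheory.Greenberg2016.LocalCohomologyAlmostDivisible
import Literature.NumberTheory.IwasawaTheory.Greenberg2006.AlmostDivisibleSpecialisation
import Literature.NumberTheory.GaloisRepresentations.ContinuousCohomologyDivisibleSequence
import HarnessLib

/-!
# Greenberg 2016, proof of Prop. 4.1.1 (p. 16 L33–34): LOC_η⁽¹⁾(𝐃) ⟹ LOC_η⁽¹⁾(𝐃[π]) for almost all
# `Π = (π)` — transfer step (T7(c)(i)) of the input (γ), theorems only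

Topic `NumberTheory/IwasawaTheory/Greenberg2016`; namespace
`Literature.NumberTheory.IwasawaTheory.Greenberg2016`; THEOREMS ONLY (no definition, no named fact,
no `sorry`). Seat `bsd-input-gr16-prop411` (literature-prover, 2026-08-28).

PRINT ([Greenberg2016Selmer] p. 16 L33–34, case (c) of Prop. 4.1.1 for `𝐃[π]`): "First of all, one
sees easily that if LOC_η⁽¹⁾(𝐃) holds, then so does LOC_η⁽¹⁾(𝐃[Π])" (for almost all `Π`; §2.4 p. 8
L27–31: "if 𝐃 satisfies LOC_v⁽¹⁾ … then 𝐃[Π] satisfies LOC_v⁽¹⁾ for almost all `Π ∈ Spec_{ht=1}(Λ)` …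
remark 3.5.1 of [Gr4]"). In the tree LOC_v⁽¹⁾ is typed on the discrete side (every
`Γ_{K_v}`-equivariant additive `𝐃 → K̄ˣ` vanishes), and the transfer is obtained through local Tate
duality in the limit, both halves of which are now theorems of the tree:
LOC_η⁽¹⁾(𝐃) ⟹ `H²(K_η, 𝐃) = 0` (`sec5A_localH2_subsingleton_of_LOC1_holds`) and
`H²(K_η, 𝐃[π]) = 0` ⟹ LOC_η⁽¹⁾(𝐃[π]) (`loc1_of_subsingleton_localH2`, `LOC1OfLocalH2Vanishing.lean`);
in between, `H²(K_η, 𝐃[π]) ↪ H²(K_η, 𝐃) = 0` as soon as `πH¹(K_η, 𝐃) = H¹(K_η, 𝐃)`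
(`ContinuousRep.smul_H_surjective_iff_Hmap_torsionBy_injective`, [Gr4] (5)–(6)), which holds for every
`π` off a finite set of primes of height `≤ 1` because `H¹(K_η, 𝐃)` is cofinitely generated
(`isCofinitelyGenerated_localRep_H`) and ALMOST DIVISIBLE — the `C = 𝐃` case of Prop. 4.2.2, proved
here directly for `localRep` (`isAlmostDivisible_localRep_H_one`, same argument as the tree's
`prop422_localCohomology_isAlmostDivisible_holds`: `H¹ = μH¹ + πH¹` from `cd_p(Γ_{K_η}) ≤ 2`).

* `isAlmostDivisible_localRep_H_one` — RFX(𝐃) and LOC_η⁽¹⁾(𝐃) ⟹ `H¹(K_η, 𝐃)` is almost divisible;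
* `exists_finite_forall_localH2_torsionBy_subsingleton` — `H²(K_η, 𝐃[π]) = 0` for all `π` off a
  finite set of primes of height `≤ 1`;
* `exists_finite_forall_loc1_torsionBy` — **LOC_η⁽¹⁾(𝐃[π]) for all `π` off a finite set of primes of
  height `≤ 1`** (T7(c)(i) of the seat's needs-X census).

HONESTY. Nothing here proves Prop. 4.1.1 or a summit statement; BSD is not advanced. AI-typed,
kernel-checked.

## References
* R. Greenberg, *On the structure of Selmer groups* (2016), §2.4 p. 8 L27–31, §4.1 p. 16 L33–34,
  Prop. 4.2.2. [Greenberg2016Selmer]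
* R. Greenberg, *On the structure of certain Galois cohomology groups*, Doc. Math. (2006), §3 B
  (5)–(6), Remark 3.5.1, §5 A. [Greenberg2006]
-/

noncomputable section

open scoped Classical
open CategoryTheory Limits
open NumberField IsDedekindDomain Field IsLocalRing
open Literature.NumberTheory.GaloisRepresentations
open Literature.NumberTheory.IwasawaTheory.Greenberg2006

namespace Literature.NumberTheory.IwasawaTheory.Greenberg2016

variable {p : ℕ} [Fact p.Prime] {K : Type} [Field K] [NumberField K]
  (S : Set (HeightOneSpectrum (𝓞 K)))
  {Λ : Type} [CommRing Λ] [TopologicalSpace Λ] [IsTopologicalRing Λ] {m : ℕ}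
  {D : Type} [AddCommGroup D] [Module Λ D] [TopologicalSpace D] [DiscreteTopology D]
  [ContinuousSMul Λ D] (ρ : ContinuousRep (GaloisGroupUnramifiedOutside K S) Λ D)

/-- **`H¹(K_η, 𝐃)` is almost divisible** under RFX(𝐃) and LOC_η⁽¹⁾(𝐃) (the `C = 𝐃` case of Prop. 4.2.2,
with `H²(K_η, 𝐃) = 0` supplied by [Gr4] §5 A): for every prime `π` and `μ ∉ (π)`,
`H¹(K_η, 𝐃) = μH¹ + πH¹` (`𝐃` and `𝐃[π]` are `π`- resp. `μ`-divisible by coreflexivity, `H² = 0`,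
`H³(K_η, 𝐃[π][μ]) = 0` by `cd_p ≤ 2`), which is Greenberg's criterion for almost divisibility.
[cite: Greenberg2016Selmer, Prop. 4.2.2 (§4.2 p. 20 L4–8); §4.1 p. 16 L33–37]
[cite: Greenberg2006, Prop. 5.3 (§5 B, p. 375), Prop. 3.7 (§3 C, p. 364)] -/
theorem isAlmostDivisible_localRep_H_one (hS : S.Finite)
    (hSp : ∀ v : HeightOneSpectrum (𝓞 K), ((p : ℕ) : 𝓞 K) ∈ v.asIdeal → v ∈ S)
    (e : Λ ≃+* MvPowerSeries (Fin m) ℤ_[p])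
    (hpD : ∀ d : D, ∃ n : ℕ, (p ^ n : ℤ) • d = 0) (hD : IsCofinitelyGenerated Λ D) (hRFX : RFX Λ D)
    {η : HeightOneSpectrum (𝓞 K)} (hLOC1 : LOC1 S ρ (Sum.inr η)) :
    IsAlmostDivisible Λ ((localRep S ρ (Sum.inr η)).H 1) := by
  -- `Λ` is a Noetherian factorial domain
  haveI : IsNoetherianRing Λ := isNoetherianRing_of_ringEquiv_mvPowerSeries e
  haveI hreg : IsRegularLocalRing (MvPowerSeries (Fin m) ℤ_[p]) :=
    NearlyOrdinaryPresentationCA.isRegularLocalRing_mvPowerSeries_dvr ℤ_[p] m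
  haveI : IsDomain (MvPowerSeries (Fin m) ℤ_[p]) :=
    Literature.AlgebraicGeometry.Resolution.isDomain_of_isRegularLocalRing _
  haveI : IsDomain Λ := MulEquiv.isDomain (MvPowerSeries (Fin m) ℤ_[p]) e.toMulEquiv
  haveI : UniqueFactorizationMonoid Λ :=
    MulEquiv.uniqueFactorizationMonoid e.symm.toMulEquiv
      (Literature.AlgebraicGeometry.Resolution.IsRegularLocalRing.uniqueFactorizationMonoid _)
  -- the local field `K_η` and its absolute Galois group
  letI : ValuativeRel (Place.Completion (Sum.inr η : Place K)) :=
    inferInstanceAs (ValuativeRel (η.adicCompletion K))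
  letI : TopologicalSpace (Place.Completion (Sum.inr η : Place K)) :=
    inferInstanceAs (TopologicalSpace (η.adicCompletion K))
  haveI : IsNonarchimedeanLocalField (Place.Completion (Sum.inr η : Place K)) :=
    inferInstanceAs (IsNonarchimedeanLocalField (η.adicCompletion K))
  haveI : CharZero (Place.Completion (Sum.inr η : Place K)) :=
    charZero_of_injective_algebraMap
      (algebraMap K (Place.Completion (Sum.inr η : Place K))).injective
  haveI : CompactSpace (absoluteGaloisGroup (Place.Completion (Sum.inr η : Place K))) :=
    absoluteGaloisGroup_compactSpace _
  -- `H²(K_η, 𝐃) = 0` ([Gr4] §5 A)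
  haveI hH2 : Subsingleton ((localRep S ρ (Sum.inr η)).H 2) :=
    sec5A_localH2_subsingleton_of_LOC1_holds p K S hS hSp Λ m ⟨e⟩ D ρ hpD hD η hLOC1
  have hcorefl : IsCoreflexive Λ D := hRFX
  set τ := localRep S ρ (Sum.inr η) with hτ
  -- `H¹(K_η, 𝐃) = μ H¹ + π H¹` for every prime `π` and `μ ∉ (π)`
  have hsum : ∀ π μ : Λ, Prime π → ¬ π ∣ μ → ∀ s : τ.H 1, ∃ a b : τ.H 1, s = μ • a + π • b := by
    intro π μ hπ hμ s
    have hdivπ : ∀ c : D, ∃ c', π • c' = c := hcorefl.smul_surjective hπ.ne_zero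
    let T : Submodule Λ D := Submodule.torsionBy Λ D π
    let τ₁ := τ.subrepresentation T (τ.torsionBy_smul_le_comap π)
    have hdivμ : ∀ t : T, ∃ t', μ • t' = t := fun t ↦ by
      obtain ⟨d', hd'π, hd'μ⟩ := hcorefl.exists_torsionBy_smul_eq hπ hμ
        ((Submodule.mem_torsionBy_iff π (t : D)).1 t.2)
      exact ⟨⟨d', (Submodule.mem_torsionBy_iff π d').2 hd'π⟩, Subtype.ext hd'μ⟩
    let τ₂ := τ₁.subrepresentation (Submodule.torsionBy Λ T μ) (τ₁.torsionBy_smul_le_comap μ)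
    -- `cd_p(Γ_{K_η}) ≤ 2`: `H³(K_η, 𝐃[π][μ]) = 0`
    have hprim : IsPrimaryTorsion p (Submodule.torsionBy Λ T μ) := fun x ↦ by
      obtain ⟨n, hn⟩ := hpD ((x : T) : D)
      refine ⟨n, Subtype.ext (Subtype.ext ?_)⟩
      have h1 : (((p ^ n • x : Submodule.torsionBy Λ T μ) : T) : D) = p ^ n • ((x : T) : D) := by
        simp only [SetLike.val_smul_of_tower]
      rw [h1]
      rw [← natCast_zsmul]
      push_cast
      simpa using hn
    have hH3 : ∀ x : continuousCohomology 3 τ₂.toTopRep, x = 0 := by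
      have hs := subsingleton_continuousCohomology_of_two_lt
        (Place.Completion (Sum.inr η : Place K)) (τ₂.restrictScalars ℤ) hprim
        (show 2 < 3 by norm_num)
      haveI : Subsingleton (τ₂.H 3) := (τ₂.subsingleton_H_restrictScalars_iff ℤ 3).1 hs
      exact fun x ↦ Subsingleton.elim (α := τ₂.H 3) x 0
    -- `μ` onto on `H²(K_η, 𝐃[π])`
    have hsurjμ : ∀ t : continuousCohomology 2 τ₁.toTopRep, ∃ t', t = μ • t' :=
      exists_eq_smul_of_forall_eq_zero τ₁ μ hdivμ 1 hH3
    exact exists_eq_add_of_forall_eq_zero τ π μ hdivπ 1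
      (fun x ↦ Subsingleton.elim (α := τ.H 2) x 0) hsurjμ s
  exact isAlmostDivisible_of_forall_exists_eq_add hsum

/-- **`H²(K_η, 𝐃[π]) = 0` for every `π` off a finite set of primes of height `≤ 1`** (under RFX(𝐃),
LOC_η⁽¹⁾(𝐃)): `H¹(K_η, 𝐃)` is cofinitely generated and almost divisible, so `πH¹(K_η, 𝐃) = H¹(K_η, 𝐃)`
for every such `π` ([Gr4] Prop. 2.4), and then `H²(K_η, 𝐃[π]) ↪ H²(K_η, 𝐃) = 0` ([Gr4] (5)–(6)).
The finite set contains `(0)`. [cite: Greenberg2016Selmer, §2.4 p. 8 L27–31; §4.1 p. 16 L33–34]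
[cite: Greenberg2006, §3 B (5)–(6) p. 360; Remark 3.5.1] -/
theorem exists_finite_forall_localH2_torsionBy_subsingleton (hS : S.Finite)
    (hSp : ∀ v : HeightOneSpectrum (𝓞 K), ((p : ℕ) : 𝓞 K) ∈ v.asIdeal → v ∈ S)
    (e : Λ ≃+* MvPowerSeries (Fin m) ℤ_[p])
    (hpD : ∀ d : D, ∃ n : ℕ, (p ^ n : ℤ) • d = 0) (hD : IsCofinitelyGenerated Λ D) (hRFX : RFX Λ D)
    {η : HeightOneSpectrum (𝓞 K)} (hLOC1 : LOC1 S ρ (Sum.inr η)) :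
    ∃ F : Set (PrimeSpectrum Λ), F.Finite ∧ (∀ P ∈ F, P.asIdeal.height ≤ 1) ∧
      ∀ π : Λ, (∀ P ∈ F, π ∉ P.asIdeal) →
        Subsingleton ((localRep S (ρ.subrepresentation (Submodule.torsionBy Λ D π)
          (ρ.torsionBy_smul_le_comap π)) (Sum.inr η)).H 2) := by
  -- `Λ` is a Noetherian domain
  haveI : IsNoetherianRing Λ := isNoetherianRing_of_ringEquiv_mvPowerSeries e
  haveI hreg : IsRegularLocalRing (MvPowerSeries (Fin m) ℤ_[p]) :=
    NearlyOrdinaryPresentationCA.isRegularLocalRing_mvPowerSeries_dvr ℤ_[p] m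
  haveI : IsDomain (MvPowerSeries (Fin m) ℤ_[p]) :=
    Literature.AlgebraicGeometry.Resolution.isDomain_of_isRegularLocalRing _
  haveI : IsDomain Λ := MulEquiv.isDomain (MvPowerSeries (Fin m) ℤ_[p]) e.toMulEquiv
  haveI : CompactSpace (absoluteGaloisGroup (Place.Completion (Sum.inr η : Place K))) :=
    absoluteGaloisGroup_compactSpace _
  haveI hH2 : Subsingleton ((localRep S ρ (Sum.inr η)).H 2) :=
    sec5A_localH2_subsingleton_of_LOC1_holds p K S hS hSp Λ m ⟨e⟩ D ρ hpD hD η hLOC1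
  have hAD := isAlmostDivisible_localRep_H_one S ρ hS hSp e hpD hD hRFX hLOC1
  have hfg : IsCofinitelyGenerated Λ ((localRep S ρ (Sum.inr η)).H 1) :=
    isCofinitelyGenerated_localRep_H S ρ e hD (Sum.inr η) 1
  obtain ⟨F, hF, hF1, hdiv⟩ := hAD.exists_finite_forall_smul_surjective hfg
  refine ⟨insert ⟨⊥, Ideal.isPrime_bot⟩ F, hF.insert _, ?_, ?_⟩
  · rintro P (rfl | hP)
    · change (⊥ : Ideal Λ).height ≤ 1
      rw [Ideal.height_bot]; exact zero_le_one
    · exact hF1 P hP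
  · intro π hπ
    have hπ0 : π ≠ 0 := fun h0 ↦ hπ ⟨⊥, Ideal.isPrime_bot⟩ (Set.mem_insert _ _) (by
      change π ∈ (⊥ : Ideal Λ); rw [h0]; exact Ideal.zero_mem _)
    have hsurj := hdiv π fun P hP ↦ hπ P (Set.mem_insert_of_mem _ hP)
    have hinj := ((localRep S ρ (Sum.inr η)).smul_H_surjective_iff_Hmap_torsionBy_injective π
      (hRFX.smul_surjective hπ0) 1).1 hsurj
    exact hinj.subsingleton

/-- **LOC_η⁽¹⁾(𝐃[π]) for every `π` off a finite set of primes of height `≤ 1`** — transfer step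
(T7(c)(i)) of the proof of Prop. 4.1.1 ("if LOC_η⁽¹⁾(𝐃) holds, then so does LOC_η⁽¹⁾(𝐃[Π])", for
almost all `Π`): `Λ ≃ ℤ_p⟦T₁,…,T_m⟧`, `𝐃` discrete `p`-primary cofinitely generated with RFX(𝐃), and
LOC_η⁽¹⁾(𝐃) at the finite place `η`. (Local Tate duality in the limit in both directions around
`H²(K_η, 𝐃[π]) = 0`.) [cite: Greenberg2016Selmer, §4.1 p. 16 L33–34; §2.4 p. 8 L27–31]
[cite: Greenberg2006, Remark 3.5.1; §5 A (pp. 372–373)] -/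
theorem exists_finite_forall_loc1_torsionBy (hS : S.Finite)
    (hSp : ∀ v : HeightOneSpectrum (𝓞 K), ((p : ℕ) : 𝓞 K) ∈ v.asIdeal → v ∈ S)
    (e : Λ ≃+* MvPowerSeries (Fin m) ℤ_[p])
    (hpD : ∀ d : D, ∃ n : ℕ, (p ^ n : ℤ) • d = 0) (hD : IsCofinitelyGenerated Λ D) (hRFX : RFX Λ D)
    {η : HeightOneSpectrum (𝓞 K)} (hLOC1 : LOC1 S ρ (Sum.inr η)) :
    ∃ F : Set (PrimeSpectrum Λ), F.Finite ∧ (∀ P ∈ F, P.asIdeal.height ≤ 1) ∧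
      ∀ π : Λ, (∀ P ∈ F, π ∉ P.asIdeal) →
        LOC1 S (ρ.subrepresentation (Submodule.torsionBy Λ D π) (ρ.torsionBy_smul_le_comap π))
          (Sum.inr η) := by
  obtain ⟨F, hF, hF1, hH2⟩ :=
    exists_finite_forall_localH2_torsionBy_subsingleton S ρ hS hSp e hpD hD hRFX hLOC1
  refine ⟨F, hF, hF1, fun π hπ ↦ ?_⟩
  refine loc1_of_subsingleton_localH2 (p := p) S _ (fun d ↦ ?_) η (hH2 π hπ)
  obtain ⟨n, hn⟩ := hpD (d : D)
  exact ⟨n, Subtype.ext (by simpa using hn)⟩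

end Literature.NumberTheory.IwasawaTheory.Greenberg2016

end
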